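import Literature.Barriers.QuantumAdvantage.PPolyOraclesProofs
import Literature.Barriers.QuantumAdvantage.SampPRelSubsetSampBQPRel
import Literature.Computability.QuantumComplexity.BPPRelSubsetBQPRel
import Literature.Computability.Complexity.OracleBPPAmplification
import Literature.Computability.Complexity.OracleCompositionMachine
import Literature.Computability.Complexity.OracleProofs
import Literature.Computability.Cryptography.StatisticalDistanceMixtures
import HarnessLib

/-!
# The model bridge `SampBQP^A ⊆ SampBPP^A ⇒ BQP^A ⊆ BPP^A` of `PPolyOracles` (Aaronson–Chen 2017, Thms. 7.6 and 8.1), proved from a one-bit padding fact; the sampling form of Thm. 7.6 from its language form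

Sibling proof file of `PPolyOraclesProofs.lean` (same barrier, D-0014/D-0021), serving the
SAMPLING form of Thm. 7.6, `OWFExist → PPolyOracleSamplingSeparation` (S. Aaronson,
L. Chen, *Complexity-theoretic foundations of quantum supremacy experiments*, CCC 2017,
arXiv:1612.05903 [AaronsonChen2017], §1 p. 10: "Relative to some efficiently computable oracle, we
can prove `SampBPP ≠ SampBQP`, but only under a weak computational assumption, like the existence
of one-way functions"; Thm. 7.6, p. 30, prints the language form `BPP^O ≠ BQP^O`). (Revision 2,
review of the split, D-0026: this statement was for a while the separate named fact
`aaronsonChen2017_thm76_samp` of `PPolyOraclesProofs.lean`; being a corollary of the language-form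
fact `aaronsonChen2017_thm76` through the two bridges below — both now tree theorems — and not a
part of any proof, it has been MERGED back: the `def` is retired, and the theorems of this file
that concluded it keep their names with the unfolded conclusion
`OWFExist → PPolyOracleSamplingSeparation`.)

`PPolyOraclesProofs.lean` proves `aaronsonChen2017_thm76_samp_of_parts`: the sampling form
follows from the language form `aaronsonChen2017_thm76` and the two MODEL BRIDGES

* `h₃ = Literature.Computability.QuantumComplexity.BPPRel_ofLanguage_subset_BQPRel`
  (`BPP^A ⊆ BQP^A` for every oracle language `A`; Bernstein–Vazirani 1997, Thm. 8.3 relativized),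
* `h₄ = BQPRel_subset_BPPRel_of_sampBQPRel_subset` (`SampBQP^A ⊆ SampBPP^A ⇒ BQP^A ⊆ BPP^A`,
  the "and consequently `BPP^O = BQP^O`" of Thm. 8.1, p. 32),

both named facts between three machine models of the tree (G01 transcript machines `PRel`/`bp`,
C4a oracle adversaries `SampPRel`, Q2 uniform Clifford+T families with XOR-query gates
`BQPRel`/`SampBQPRel`). The bridge `h₃` is meanwhile PROVED in the tree from the named fact
`Literature.Computability.QuantumComplexity.uniformOracleCoinSimulation`
(`QuantumComplexity/CoinFamilyKernel.lean`: the polynomial-time uniform reversible simulation, with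
oracle gates, of an `FP^A` function of `⟨x, coins⟩` after a Hadamard coin layer — the relativized
classical core of Bernstein–Vazirani's Thm. 8.3, whose coin-free one-bit case is PROVED in the
tree, `SimUniformity.lean`): `BPPRel_ofLanguage_subset_BQPRel_of_sim`
(`QuantumComplexity/BPPRelSubsetBQPRel.lean`), next to `SampPRel_subset_SampBQPRel_of_sim`
(`SampPRelSubsetSampBQPRel.lean`). This file PROVES the bridge `h₄` down to one smaller
quantum-side fact and assembles the sampling form of Thm. 7.6:

* **`kernelProb_headD_true`, `kernelProb_headD_false`** — the acceptance probability of a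
  Clifford+T oracle family (wire `0`) is the kernel probability of "first output bit `true`" (Born
  rule on all wires, `toReal_outputPMF_map_ofFn`), and one minus that of "first output bit
  `false`" (unit norm of the output state, `QCircuit.normSq_runOn_basisState`).
* **`verdictSampling_mem_SampBQPRel`** (named fact, the quantum half of `h₄`): the first output
  bit of a polynomial-time uniform Clifford+T oracle family `F`, as the one-bit sampling problem
  `verdictSampling F A : x ↦ law of [first bit of F^A(x)]`, is in `SampBQP^A` — in Aaronson–Chen's
  canonical form of `SampBQP` oracle algorithms (§2.2, p. 12: "given an input `⟨x, 0^{1/ε}⟩`, `M`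
  first uses a classical routine … to output a quantum circuit `C` … in polynomial time … runs [it]
  … and measures all the qubits … finally uses another classical routine `A^output` on the
  outcome") this is "print `F_{|x|}` loaded with `x`, ignore `0^{1/ε}`, output the first measured
  bit"; in the tree's Q2 model (circuits indexed by the input LENGTH and fed `|⟨x, 1^k⟩⟩`) it is the
  circuit plumbing "unpair the input in place and run `F_{|x|}` on the first field, for every
  splitting of the length", left as the one remaining quantum-side leaf of `h₄`.
* **`BQPRel_subset_BPPRel_of_sampBQPRel_subset_of_verdict`** — `h₄` from that fact (the
  classical half, PROVED): given `SampBQP^A ⊆ SampBPP^A` and `L ∈ BQP^A` by the uniform family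
  `F`, the verdict problem of `F` has a `SampBPP^A` sampler `𝒜` (a PPT oracle adversary, C4a);
  run it with accuracy `1/12`: the deterministic function
  `g ⟨x, r⟩ = out_𝒜(⟨x, 1^{12}⟩; r)` is in `FP^A` (`OracleAdversary.clockedRun_mem_FPRel`,
  `Cryptography/OracleAdversaryFPRel.lean`, precomposed with the polynomial-time re-encoding
  `⟨x, r⟩ ↦ ⟨⟨x, 1^{12}⟩, r⟩`, `comp_FP_mem_FPRel`), so the witness language
  `L' = {v | first bit of g v}` is in `P^A` (`headDLang_mem_PRel`: one query to `g`, `karpAlg`,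
  then `P^{FP^A} ⊆ P^A`, `OracleAlg.PRel_subset_PRel_of_mem_FPRel`); every event moves by at most
  the statistical distance (`PMF.abs_toReal_toOuterMeasure_sub_le_tvDist`), so the coins giving
  the right verdict have probability `≥ 2/3 − 1/12 = 7/12`, i.e. `L ∈ bpErr (P^A) (5/12)`, and
  `5/12 < 1/2` is amplified to `BPP^A` by the tree's relativized majority vote
  (`bpErr_PRel_subset_BPPRel`, `Complexity/OracleBPPAmplification.lean`).
* Assemblies: `pPolyOracleSamplingSeparation_of_pPolyOracleSeparation_of_sim`,
  `aaronsonChen2017_thm76_samp_of_sim` (the sampling form of Thm. 7.6 from its language form and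
  the two quantum-side facts), `aaronsonChen2017_thm76_samp_of_sim_leaves` (down to HILL, GGM,
  Luby–Rackoff and the §7.2–7.3 fact), `aaronsonChen2017_thm81_of_sim` and `PPolyOracles_of_sim`
  (Thm. 8.1 and the barrier conjunction with all three bridges `h₂, h₃, h₄` replaced by
  `uniformOracleCoinSimulation` and `verdictSampling_mem_SampBQPRel`; the sibling
  `PPolyOraclesDecision.lean` reaches Thm. 8.1's "consequently" instead through a decision form of
  Lemma 8.2, which does not serve Thm. 7.6).

So, after this file, the sampling form of Thm. 7.6 awaits exactly: `aaronsonChen2017_thm76`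
(language form; its own leaves HILL `PRGExist_iff_OWFExist`, GGM `PRFExist_of_PRGExist`,
Luby–Rackoff `PRPExist_of_PRFExist` and `aaronsonChen2017_thm76_of_prp`, the latter decomposed in
`PPolyOraclesThm76.lean`), `uniformOracleCoinSimulation_holds` and
`verdictSampling_mem_SampBQPRel_holds` — the last two are meanwhile tree theorems
(`QuantumComplexity/CoinFamilyKernelProofs.lean`, `PPolyOraclesBridgesProofs.lean`), so that
`PPolyOraclesBridgesProofs.lean` states it from `aaronsonChen2017_thm76` ALONE
(`pPolyOracleSamplingSeparation_of_thm76`).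

## Design notes

* `verdictSampling F A x := (F.kernel A x).map (o ↦ [o.headD false])`: a `PMF` by construction
  (no appeal to `acceptProb ≤ 1`); its mass at `[true]` is `F.acceptProbOn A x`
  (`kernelProb_headD_true`), at `[false]` it is `1 − F.acceptProbOn A x` (`kernelProb_headD_false`).
* The accuracy `1/12` and the error `5/12` are one admissible choice (`2/3 − 1/k > 1/2` needs
  `k > 6`); the threshold `2/3` of `bp` is restored by `bpErr_PRel_subset_BPPRel` (any error
  `< 1/2`).
* Coins: the sampler's coin budget is read in the length of ITS input `⟨x, 1^{12}⟩`, of length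
  `2|x| + 14` (`length_boolPair`), so the coin polynomial of the `bp` witness is
  `𝒜.coins ∘ (2X + 14)`.

## Sources

* [AaronsonChen2017] arXiv:1612.05903 (held, `lit read arxiv-1612.05903`): §1 p. 10 (ll. 1–7,
  "smooth tradeoff"), §2.2 Def. 2.3 and the canonical form of `SampBQP` oracle algorithms (p. 12,
  ll. 37–62), Thm. 7.6 (p. 30, ll. 18–40), Thm. 8.1 with "and consequently `BPP^O = BQP^O`" and
  its proof from Lemma 8.2 (p. 32, ll. 7–32).
* [BernsteinVazirani1997SICOMP] E. Bernstein, U. Vazirani, *Quantum complexity theory*, SIAM J.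
  Comput. 26 (1997), Thm. 8.3 (`BPP ⊆ BQP`) and §8.3 (oracle QTMs), as cited by
  `QuantumComplexity/CoinFamilyKernel.lean` and `QuantumComplexity/BPPRelSubsetBQPRel.lean`.
* [NielsenChuang2010] §2.2.5 (Born rule), as cited by `Cryptography/QuantumCircuitProofs.lean`.
* [AroraBarakCC2009] §7.4.1 with Thm. 7.10 (error reduction "we can replace `2/3` with any
  constant larger than `1/2`"), §3.4 (oracle machines), as cited by
  `Complexity/OracleBPPAmplification.lean`, `Complexity/OracleClosure.lean`.
-/

noncomputable section

namespace Literature.Barriers.QuantumAdvantage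

open _root_.Computability Literature.Computability.Complexity Literature.Computability.Complexity.Classes
  Literature.Computability.Cryptography Literature.Computability.QuantumComplexity
open Literature.Computability.Complexity.Brick

/-! ### The first output bit of a circuit family: kernel probabilities versus acceptance -/

/-- The first entry of the read-out `ofFn z` of a register, with default: the value of wire `0`
if there is one, else the default. [folklore] -/
theorem headD_ofFn {N : ℕ} (z : Fin N → Bool) (b : Bool) :
    (List.ofFn z).headD b = if h : 0 < N then z ⟨0, h⟩ else b := by
  cases N with
  | zero => simp
  | succ N => simp [List.ofFn_succ]

/-- **Acceptance is the kernel probability of "first output bit `true`"**: for a Clifford+T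
family with oracle gates, `Pr[the measured output string starts with 1] = F.acceptProbOn A x`
(both are the Born mass of the outcomes whose wire `0` reads `true`; on the empty register both
are `0`). [cite: NielsenChuang2010, §2.2.5 (Born rule)] -/
theorem kernelProb_headD_true (A : Language Bool) (F : QCircuitFamily cliffordT) (x : List Bool) :
    F.kernelProb A x {o | o.headD false = true} = F.acceptProbOn A x := by
  classical
  unfold QCircuitFamily.kernelProb QCircuitFamily.kernel QCircuitFamily.acceptProbOn
    QCircuit.acceptProb
  rw [toReal_outputPMF_map_ofFn]
  refine Finset.sum_congr rfl fun z _ => ?_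
  simp only [Set.mem_setOf_eq, headD_ofFn]
  by_cases h : 0 < x.length + F.ancillas x.length
  · simp [h]
  · simp [h]

/-- **The complementary event**: `Pr[the measured output string starts with 0] = 1 − F.acceptProbOn A x`
(the output state of a circuit over a unitary gate set is a unit vector,
`QCircuit.normSq_runOn_basisState`; on the empty register the left side is `1` and the acceptance
probability is `0`). [cite: NielsenChuang2010, §2.2.5 (Born rule, probabilities sum to one)] -/
theorem kernelProb_headD_false (A : Language Bool) (F : QCircuitFamily cliffordT) (x : List Bool) :
    F.kernelProb A x {o | o.headD false = false} = 1 - F.acceptProbOn A x := by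
  classical
  have hnorm := QCircuit.normSq_runOn_basisState cliffordT_isUnitary_holds A (F.circ x.length) x.get
  unfold normSq at hnorm
  rw [← kernelProb_headD_true, eq_sub_iff_add_eq, ← hnorm]
  unfold QCircuitFamily.kernelProb QCircuitFamily.kernel
  rw [toReal_outputPMF_map_ofFn, toReal_outputPMF_map_ofFn, ← Finset.sum_add_distrib]
  refine Finset.sum_congr rfl fun z _ => ?_
  simp only [Set.mem_setOf_eq]
  rcases Bool.eq_false_or_eq_true ((List.ofFn z).headD false) with hz | hz <;> simp only [hz] <;> simp

/-! ### The verdict of a circuit family as a one-bit sampling problem (the quantum half of `h₄`) -/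

/-- **The verdict sampling problem of a circuit family**: `x ↦` the law of the one-bit string
`[first bit of the measured output of F_{|x|} on |x⟩|0…0⟩, relative to A]` — mass
`F.acceptProbOn A x` at `[true]` and `1 − F.acceptProbOn A x` at `[false]`
(`kernelProb_headD_true`, `kernelProb_headD_false`). The sampling problem solved by a `BQP^A`
decider read as a `SampBQP^A` algorithm in Aaronson–Chen's canonical form.
[cite: AaronsonChen2017, §2.2 (canonical form of SampBQP oracle algorithms, p. 12) and Thm. 8.1 ("and consequently", p. 32)] -/
def verdictSampling (F : QCircuitFamily cliffordT) (A : Language Bool) : SamplingProblem :=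
  fun x => (F.kernel A x).map fun o => [o.headD false]

/-- Unfolding: the probability of an event under the verdict problem is the kernel probability of
the strings whose first bit, as a one-bit string, lies in the event. [folklore] -/
theorem toReal_verdictSampling_toOuterMeasure (F : QCircuitFamily cliffordT) (A : Language Bool)
    (x : List Bool) (E : Set (List Bool)) :
    ((verdictSampling F A x).toOuterMeasure E).toReal = F.kernelProb A x {o | [o.headD false] ∈ E} := by
  unfold verdictSampling QCircuitFamily.kernelProb
  rw [PMF.toOuterMeasure_map_apply]
  rfl

/-- **Named fact (quantum half of `h₄`): the verdict of a uniform oracle family is a `SampBQP^A`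
problem.** For every oracle language `A` and every polynomial-time uniform Clifford+T family `F`
with XOR-query gates, `verdictSampling F A ∈ SampBQPRel A`: some uniform family `F'` with a
polynomial-time post-processing, run on `|⟨x, 1^k⟩⟩|0…0⟩` relative to `A`, outputs `[b]` with `b`
distributed as the first output bit of `F_{|x|}` on `|x⟩|0…0⟩`, within total variation `1/k`
(indeed exactly). In Aaronson–Chen's canonical form (§2.2: the circuit is printed from the input
`⟨x, 0^{1/ε}⟩` by a classical polynomial-time routine, run on `|0…0⟩`, measured, and classically
post-processed) this is immediate — print `F_{|x|}` with `x` loaded and output the first measured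
bit, ignoring the accuracy parameter; in the tree's Q2 model, whose circuits are indexed by the
input LENGTH and fed the basis state of the whole input `⟨x, 1^k⟩`, it is the circuit plumbing
"copy the first field of the self-delimiting pairing out of the input and apply `F_m` to it, one
block for each candidate length `m`, the post-processing selecting the block of the actual
length" (uniformity from that of `F`). Stated as a named fact; it is the padding step "the output
bit of a `BQP^A` family is a `SampBQP^A` problem (pad the accuracy parameter away uniformly)" of
the tree's `BQPRel_subset_BPPRel_of_sampBQPRel_subset`.
[cite: AaronsonChen2017, §2.2 (canonical form of SampBQP oracle algorithms, p. 12) and Thm. 8.1 ("and consequently BPP^O = BQP^O", p. 32)] -/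
def verdictSampling_mem_SampBQPRel : Prop :=
  ∀ (A : Language Bool) (F : QCircuitFamily cliffordT), F.IsUniform → verdictSampling F A ∈ SampBQPRel A

/-! ### `SampBQP^A ⊆ SampBPP^A ⇒ BQP^A ⊆ BPP^A` from the padding fact (the classical half, proved) -/

/-- **A first-bit test on an `FP^O` function is a `P^O` language**: for `g ∈ FP^O`,
`{v | the first bit of g v is 1} ∈ P^O` — one query `v` to the function oracle `g` and output the
first bit of the answer (`karpAlg id`), then `P^{g} ⊆ P^O` for `g ∈ FP^O`
(`OracleAlg.PRel_subset_PRel_of_mem_FPRel`, `P^{FP^O} = P^O`).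
[cite: AroraBarakCC2009, §3.4 (oracle machines compose, Claim 1.6)] -/
theorem headDLang_mem_PRel {O : Oracle} {g : List Bool → List Bool} (hg : g ∈ FPRel O) :
    {v | (g v).headD false = true} ∈ PRel O := by
  refine OracleAlg.PRel_subset_PRel_of_mem_FPRel hg ?_
  refine ⟨karpAlg id, isPolyTime_karpAlg (PolyTimeComputable.id _), Polynomial.X + 2, fun v => ⟨?_, ?_⟩⟩
  · have hq : (Polynomial.X + 2 : Polynomial ℕ).eval v.length = v.length + 2 := by simp
    rw [hq, run_karpAlg]
    simp only [id, Option.some.injEq]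
    rcases hb : (g v).headD false with _ | _
    · symm
      apply (Set.notMem_iff_boolIndicator _ _).1
      show ¬ ((g v).headD false = true)
      rw [hb]
      decide
    · symm
      apply (Set.mem_iff_boolIndicator _ _).1
      show (g v).headD false = true
      exact hb
  · intro y hy
    have hq : (Polynomial.X + 2 : Polynomial ℕ).eval v.length = v.length + 2 := by simp
    rw [hq, queries_karpAlg] at hy
    rw [hq, List.eq_of_mem_singleton hy]
    simp

/-- The output law of an oracle adversary read through `none ↦ []`: the probability of an event is
the fraction of coin strings whose deterministic run lands in it. [cite: AroraBarakCC2009, Def. 7.1 (probabilistic machines as deterministic machines reading coins)] -/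
theorem toReal_outputPMF_getD_toOuterMeasure (𝒜 : OracleAdversary (List Bool)) (O : Oracle)
    (w : List Bool) (E : Set (List Bool)) :
    ((PMF.map (fun o => o.getD []) (𝒜.outputPMF O w)).toOuterMeasure E).toReal =
      uniformProb (𝒜.coins.eval w.length)
        {c | (𝒜.alg.run O (𝒜.fuel.eval w.length) (boolPair w c)).getD [] ∈ E} := by
  rw [uniformProb_eq_toOuterMeasure, PMF.toOuterMeasure_map_apply, OracleAdversary.outputPMF_eq_map,
    PMF.toOuterMeasure_map_apply]
  rfl

/-- **`SampBQP^A ⊆ SampBPP^A ⇒ BQP^A ⊆ BPP^A`, from the padding fact** — the "and consequently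
`BPP^O = BQP^O`" step of Aaronson–Chen's Thm. 8.1, classical half proved: the verdict problem of
the `BQP^A` family is in `SampBQP^A` (`verdictSampling_mem_SampBQPRel`), hence has a `SampBPP^A`
sampler `𝒜`; with accuracy `1/12` its first output bit is the right verdict for at least
`2/3 − 1/12 = 7/12` of the coin strings (`PMF.abs_toReal_toOuterMeasure_sub_le_tvDist`,
`kernelProb_headD_true/false`); the map `⟨x, r⟩ ↦ first bit of out_𝒜(⟨x, 1^{12}⟩; r)` is a `P^A`
test (`OracleAdversary.clockedRun_mem_FPRel`, `comp_FP_mem_FPRel`, `headDLang_mem_PRel`), so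
`L ∈ bpErr (P^A) (5/12) ⊆ BPP^A` (`bpErr_PRel_subset_BPPRel`: majority vote restores `2/3`).
[cite: AaronsonChen2017, Thm. 8.1 ("and consequently BPP^O = BQP^O", p. 32)] [cite: AroraBarakCC2009, §7.4.1 with Thm. 7.10 (error reduction)] -/
theorem BQPRel_subset_BPPRel_of_sampBQPRel_subset_of_verdict (hQ : verdictSampling_mem_SampBQPRel) :
    BQPRel_subset_BPPRel_of_sampBQPRel_subset := by
  classical
  intro A hsub L hL
  obtain ⟨F, hU, hgap⟩ := hL
  obtain ⟨𝒜, h𝒜, hacc⟩ := hsub (hQ A F hU)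
  -- the re-encoding `⟨x, r⟩ ↦ ⟨⟨x, 1^{12}⟩, r⟩` and the clocked run of the sampler after it
  set pre : List Bool → List Bool :=
    fanoutFn (fanoutFn fstF (fun _ => unaryEncodeNat 12)) sndF with hpre
  have hpre_mem : pre ∈ FP :=
    fanoutFn_mem_FP (fanoutFn_mem_FP fstF_mem_FP (const_mem_FP _)) sndF_mem_FP
  have hpre_apply : ∀ x r : List Bool,
      pre (boolPair x r) = boolPair (boolPair x (unaryEncodeNat 12)) r := by
    intro x r
    simp [hpre]
  set g : List Bool → List Bool :=
    (fun w => (𝒜.alg.run (Oracle.ofLanguage A)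
      (𝒜.fuel.eval (boolUnpair w).1.length) w).getD []) ∘ pre with hg
  have hgmem : g ∈ FPRel (Oracle.ofLanguage A) :=
    comp_FP_mem_FPRel (𝒜.clockedRun_mem_FPRel h𝒜 A) hpre_mem
  have hg_apply : ∀ x r : List Bool, g (boolPair x r) =
      (𝒜.alg.run (Oracle.ofLanguage A) (𝒜.fuel.eval (boolPair x (unaryEncodeNat 12)).length)
        (boolPair (boolPair x (unaryEncodeNat 12)) r)).getD [] := by
    intro x r
    simp only [hg, Function.comp_apply, hpre_apply, boolUnpair_boolPair]
  -- the witness language and the coin polynomial of the `bp` presentation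
  set L' : Language Bool := {v | (g v).headD false = true} with hL'
  have hL'mem : L' ∈ PRel (Oracle.ofLanguage A) := headDLang_mem_PRel hgmem
  set p : Polynomial ℕ := 𝒜.coins.comp (2 * Polynomial.X + 14) with hp
  have hlen : ∀ x : List Bool, (boolPair x (unaryEncodeNat 12)).length = 2 * x.length + 14 := by
    intro x
    rw [length_boolPair]
    have : (unaryEncodeNat 12).length = 12 := unary_decode_encode_nat 12
    omega
  have hp_eval : ∀ x : List Bool,
      p.eval x.length = 𝒜.coins.eval (boolPair x (unaryEncodeNat 12)).length := by
    intro x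
    rw [hlen, hp, Polynomial.eval_comp]
    simp
  refine bpErr_PRel_subset_BPPRel A (by norm_num : (5 / 12 : ℝ) < 1 / 2) ⟨L', hL'mem, p, fun x => ?_⟩
  -- the error bound on input `x`
  set w : List Bool := boolPair x (unaryEncodeNat 12) with hw
  set b : Bool := L.boolIndicator x with hb
  -- (1) the verdict problem puts mass `≥ 2/3` on the right bit
  have hS : (2 / 3 : ℝ) ≤ ((verdictSampling F A x).toOuterMeasure {o | o.headD false = b}).toReal := by
    rw [toReal_verdictSampling_toOuterMeasure]
    simp only [Set.mem_setOf_eq, List.headD_cons]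
    by_cases hx : x ∈ L
    · have hbt : b = true := (Set.mem_iff_boolIndicator _ _).1 hx
      rw [hbt, kernelProb_headD_true]
      exact (hgap x).1 hx
    · have hbf : b = false := (Set.notMem_iff_boolIndicator _ _).1 hx
      rw [hbf, kernelProb_headD_false]
      have := (hgap x).2 hx
      linarith
  -- (2) the sampler is `1/12`-close, so its verdict bit is right with probability `≥ 7/12`
  have hQ : (7 / 12 : ℝ) ≤ uniformProb (𝒜.coins.eval w.length)
      {c | ((𝒜.alg.run (Oracle.ofLanguage A) (𝒜.fuel.eval w.length) (boolPair w c)).getD []).headD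
        false = b} := by
    have h1 := PMF.abs_toReal_toOuterMeasure_sub_le_tvDist
      (PMF.map (fun o => o.getD []) (𝒜.outputPMF (Oracle.ofLanguage A) w)) (verdictSampling F A x)
      {o | o.headD false = b}
    have h2 : (PMF.map (fun o => o.getD []) (𝒜.outputPMF (Oracle.ofLanguage A) w)).tvDist
        (verdictSampling F A x) ≤ 1 / 12 := by
      have := hacc x 12 (by norm_num)
      norm_num at this
      exact this
    rw [toReal_outputPMF_getD_toOuterMeasure] at h1
    rw [abs_le] at h1
    have h3 := h1.1
    change (7 / 12 : ℝ) ≤ uniformProb (𝒜.coins.eval w.length)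
      {c | (𝒜.alg.run (Oracle.ofLanguage A) (𝒜.fuel.eval w.length) (boolPair w c)).getD [] ∈
        {o : List Bool | o.headD false = b}}
    linarith
  -- (3) those coins are exactly the coins giving the right verdict of the `bp` presentation
  have hset : {r : List Bool | boolPair x r ∈ L' ↔ x ∈ L} =
      {c | ((𝒜.alg.run (Oracle.ofLanguage A) (𝒜.fuel.eval w.length) (boolPair w c)).getD []).headD
        false = b} := by
    have hxb : x ∈ L ↔ b = true := by
      rw [hb]
      exact Set.mem_iff_boolIndicator (L : Set (List Bool)) x
    ext r
    change ((g (boolPair x r)).headD false = true ↔ x ∈ L) ↔ _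
    rw [hg_apply, ← hw, hxb]
    exact Bool.eq_iff_iff.symm
  rw [← Set.compl_setOf, Literature.Computability.Complexity.uniformProb_compl, hp_eval, ← hw, hset]
  linarith

/-! ### Assemblies -/

/-- **A language separation relative to `O` is a sampling separation relative to `O`**, with the
two bridges fed by the quantum-side facts. [cite: AaronsonChen2017, Thm. 8.1 ("and consequently BPP^O = BQP^O", p. 32)] -/
theorem pPolyOracleSamplingSeparation_of_pPolyOracleSeparation_of_sim
    (hsim : uniformOracleCoinSimulation) (hQ : verdictSampling_mem_SampBQPRel)
    (hsep : PPolyOracleSeparation) : PPolyOracleSamplingSeparation :=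
  pPolyOracleSamplingSeparation_of_pPolyOracleSeparation (BPPRel_ofLanguage_subset_BQPRel_of_sim hsim)
    (BQPRel_subset_BPPRel_of_sampBQPRel_subset_of_verdict hQ) hsep

/-- **Thm. 7.6 in sampling form from its language form** and the two quantum-side facts
(relativized reversible simulation; verdict padding): the three leaves of the sampling form are
`aaronsonChen2017_thm76` (sibling decomposition), `uniformOracleCoinSimulation`,
`verdictSampling_mem_SampBQPRel`. (Revision 2: conclusion stated unfolded,
`OWFExist → PPolyOracleSamplingSeparation`, formerly the retired named fact
`aaronsonChen2017_thm76_samp`.) [cite: AaronsonChen2017, §1 (p. 10) and Thm. 7.6 (p. 30)] -/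
theorem aaronsonChen2017_thm76_samp_of_sim (h76 : aaronsonChen2017_thm76)
    (hsim : uniformOracleCoinSimulation) (hQ : verdictSampling_mem_SampBQPRel) (howf : OWFExist) :
    PPolyOracleSamplingSeparation :=
  pPolyOracleSamplingSeparation_of_pPolyOracleSeparation (BPPRel_ofLanguage_subset_BQPRel_of_sim hsim)
    (BQPRel_subset_BPPRel_of_sampBQPRel_subset_of_verdict hQ) (h76 howf)

/-- **Thm. 7.6 in sampling form from the leaves**: HILL, GGM, Luby–Rackoff, the §7.2–7.3 fact, the
relativized reversible simulation and the verdict padding fact.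
[cite: AaronsonChen2017, Lemma 7.4, Thm. 7.6 (pp. 29–30) and §1 (p. 10)] -/
theorem aaronsonChen2017_thm76_samp_of_sim_leaves (hHILL : PRGExist_iff_OWFExist)
    (hGGM : PRFExist_of_PRGExist) (hLR : PRPExist_of_PRFExist)
    (h76 : aaronsonChen2017_thm76_of_prp) (hsim : uniformOracleCoinSimulation)
    (hQ : verdictSampling_mem_SampBQPRel) (howf : OWFExist) : PPolyOracleSamplingSeparation :=
  aaronsonChen2017_thm76_samp_of_sim (aaronsonChen2017_thm76_of_parts' hHILL hGGM hLR h76) hsim hQ howf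

/-- **Thm. 8.1 from Lemma 8.2 and the two quantum-side facts**: all three bridges of
`aaronsonChen2017_thm81_of_lem82` (`SampBPP^A ⊆ SampBQP^A`, `BPP^A ⊆ BQP^A`,
`SampBQP^A ⊆ SampBPP^A ⇒ BQP^A ⊆ BPP^A`) come from `uniformOracleCoinSimulation`
(`SampPRel_subset_SampBQPRel_of_sim`, `BPPRel_ofLanguage_subset_BQPRel_of_sim`) and
`verdictSampling_mem_SampBQPRel` (compare `aaronsonChen2017_thm81_of_lem82_decision` of
`PPolyOraclesDecision.lean`, through a decision form of Lemma 8.2 instead).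
[cite: AaronsonChen2017, Thm. 8.1 and Lemma 8.2 (p. 32)] -/
theorem aaronsonChen2017_thm81_of_sim (h82 : aaronsonChen2017_lem82)
    (hsim : uniformOracleCoinSimulation) (hQ : verdictSampling_mem_SampBQPRel) :
    aaronsonChen2017_thm81 :=
  aaronsonChen2017_thm81_of_lem82 h82 (SampPRel_subset_SampBQPRel_of_sim hsim)
    (BPPRel_ofLanguage_subset_BQPRel_of_sim hsim) (BQPRel_subset_BPPRel_of_sampBQPRel_subset_of_verdict hQ)

/-- **The barrier `PPolyOracles` from its leaves**, bridges discharged: HILL, GGM, Luby–Rackoff,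
the §7.2–7.3 fact, Lemma 8.2, the relativized reversible simulation and the verdict padding fact.
[cite: AaronsonChen2017, Thm. 7.6, Thm. 8.1, Lemma 7.4, Lemma 8.2] -/
theorem PPolyOracles_of_sim (hHILL : PRGExist_iff_OWFExist) (hGGM : PRFExist_of_PRGExist)
    (hLR : PRPExist_of_PRFExist) (h76 : aaronsonChen2017_thm76_of_prp)
    (h82 : aaronsonChen2017_lem82) (hsim : uniformOracleCoinSimulation)
    (hQ : verdictSampling_mem_SampBQPRel) : PPolyOracles :=
  ⟨aaronsonChen2017_thm76_of_parts' hHILL hGGM hLR h76, aaronsonChen2017_thm81_of_sim h82 hsim hQ⟩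

end Literature.Barriers.QuantumAdvantage

end
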